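import Literature.NumberTheory.LFunctions.ClassGroupXiPair
import Literature.NumberTheory.LFunctions.ClassGroupPairLSeries
import Literature.NumberTheory.LFunctions.SymmetricHadamardDerivatives
import Literature.NumberTheory.LFunctions.DedekindGammaFactorDerivatives
import HarnessLib

/-!
# The explicit formula for the higher derivatives of `−L'/L(s,χ) − L'/L(s,χ⁻¹)`, class group characters

Topic `Literature/NumberTheory/LFunctions` (namespace `Literature.NumberTheory.LFunctions.NumberField`),
continuing `ClassGroupXiPair.lean` (`Ξ_χ = ξ(·,χ)ξ(·,χ⁻¹)`, symmetric entire;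
`Ξ_χ'/Ξ_χ = 2/s + 2/(s−1) + 2γ_K'/γ_K + L'/L(χ) + L'/L(χ⁻¹)` on `Re s > 1`),
`SymmetricHadamardDerivatives.lean` (`(F'/F)^{(k)}(s) = (−1)^k k!(2m(s−½)^{−k−1} + Σₙ Zₙ(k,s))`) and
`DedekindGammaFactorDerivatives.lean` (`(γ_K'/γ_K)^{(k)}`).  Everything here is PROVED (theorems only).

For a class group character `χ` of `K` (trivial or not), `D : SymmHadamardData (Ξ_χ)`, `Re s > 1`, `k ≥ 1`,
with `Λ_χ = twistVonMangoldt K χ` (so `−L'/L(s,χ) = Σ Λ_χ(n) n^{−s}`, `neg_logDeriv_classGroupLFunction_eq`):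

  `((−1)^k/k!) [ (L(Λ_χ,·))^{(k)}(s) + (L(Λ_{χ⁻¹},·))^{(k)}(s) ]`
  `   = 2(s−1)^{−(k+1)} + 2s^{−(k+1)} − 2 Σ_{j≥0} ( r₁ (s+2j)^{−(k+1)} + r₂ (s+j)^{−(k+1)} )`
  `     − 2m (s−½)^{−(k+1)} − Σₙ Zₙ(k,s)`                                   (`pairExplicitFormula`)

where `1/2 ± ζₙ` are the zeros of `Ξ_χ` (`Zₙ = D.zeroTerm`), `2m` its order at `1/2`.  The left side is
`(1/k!) Σ_n (Λ_χ(n) + Λ_{χ⁻¹}(n)) (log n)^k n^{−s}` (`pairLSeries`, `ClassGroupPairLSeries.lean`).  This is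
[cite: ThornerZaman2017, §5 (5.1) and §7 (7.3)] / [cite: LagariasMontgomeryOdlyzko1979, §3 (3.5)] for the
pair `χ, χ̄` and the Hilbert class field (`Q = 1`), in exact form (all zeros, true multiplicities, no
error term), as needed by the Deuring–Heilbronn power-sum argument.

## References

* J. Thorner, A. Zaman, Algebra Number Theory 11 (2017), §5, §7. [ThornerZaman2017]
* J. C. Lagarias, H. L. Montgomery, A. M. Odlyzko, Invent. Math. 54 (1979), §3. [LagariasMontgomeryOdlyzko1979]
-/

noncomputable section

open scoped NumberField LSeries.notation
open Complex Filter Topology Set Metric NumberField NumberField.InfinitePlace LSeries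

namespace Literature.NumberTheory.LFunctions.NumberField

open Literature.NumberTheory.LFunctions.Stark1974 Literature.Analysis.Complex

variable {K : Type*} [Field K] [NumberField K]

/-! ### The explicit formula -/

/-- The rational part: `(d/dz)^k [2/z + 2/(z−1)](s) = (−1)^k k! (2 s^{−(k+1)} + 2 (s−1)^{−(k+1)})`
for `s ∉ {0, 1}`. [folklore] -/
theorem iteratedDeriv_poleTerms {s : ℂ} (hs0 : s ≠ 0) (hs1 : s ≠ 1) (k : ℕ) :
    iteratedDeriv k (fun z : ℂ ↦ 2 / z + 2 / (z - 1)) s =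
      (-1) ^ k * k.factorial * (2 * (s ^ (k + 1))⁻¹ + 2 * ((s - 1) ^ (k + 1))⁻¹) := by
  have h0 : ContDiffAt ℂ k (fun z : ℂ ↦ 2 * (fun w : ℂ ↦ (w - 0)⁻¹) z) s :=
    contDiffAt_const.mul ((contDiffAt_id.sub contDiffAt_const).inv (by simpa using hs0))
  have h1 : ContDiffAt ℂ k (fun z : ℂ ↦ 2 * (fun w : ℂ ↦ (w - 1)⁻¹) z) s :=
    contDiffAt_const.mul ((contDiffAt_id.sub contDiffAt_const).inv (by simpa [sub_eq_zero] using hs1))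
  have hfun : (fun z : ℂ ↦ 2 / z + 2 / (z - 1)) =
      fun z ↦ 2 * (fun w : ℂ ↦ (w - 0)⁻¹) z + 2 * (fun w : ℂ ↦ (w - 1)⁻¹) z := by
    funext z; simp [div_eq_mul_inv]
  rw [hfun, iteratedDeriv_fun_add h0 h1, iteratedDeriv_const_mul_field, iteratedDeriv_const_mul_field,
    iteratedDeriv_inv_sub_const, iteratedDeriv_inv_sub_const, sub_zero]
  ring

/-- **The explicit formula for the `k`-th derivatives of the pair `−L'/L(χ) − L'/L(χ⁻¹)`** at a point
with `Re s > 1`, `k ≥ 1`: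
`((−1)^k/k!)[(L(Λ_χ))^{(k)}(s) + (L(Λ_{χ⁻¹}))^{(k)}(s)] = 2(s−1)^{−k−1} + 2s^{−k−1}
 − 2Σ_j (r₁(s+2j)^{−k−1} + r₂(s+j)^{−k−1}) − 2m(s−½)^{−k−1} − Σₙ Zₙ(k,s)`.
[cite: ThornerZaman2017, §7 (7.3)] [cite: LagariasMontgomeryOdlyzko1979, §3 (3.5)] -/
theorem pairExplicitFormula (χ : ClassGroup (𝓞 K) →* ℂˣ) (D : SymmHadamardData (classXiPair K χ))
    {s : ℂ} (hs : 1 < s.re) {k : ℕ} (hk : 1 ≤ k) :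
    ((-1) ^ k / k.factorial : ℂ) *
        (iteratedDeriv k (LSeries (twistVonMangoldt K (classGroupCharIdealHom χ))) s +
          iteratedDeriv k (LSeries (twistVonMangoldt K (classGroupCharIdealHom χ⁻¹))) s) =
      2 * ((s - 1) ^ (k + 1))⁻¹ + 2 * (s ^ (k + 1))⁻¹ -
        2 * ∑' j : ℕ, ((nrRealPlaces K : ℂ) * ((s + 2 * j) ^ (k + 1))⁻¹ +
          (nrComplexPlaces K : ℂ) * ((s + j) ^ (k + 1))⁻¹) -
        (2 * D.m * ((s - 1 / 2) ^ (k + 1))⁻¹ + ∑' n, D.zeroTerm k s n) := by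
  have hs0' : 0 < s.re := by linarith
  have hs0 : s ≠ 0 := fun h ↦ by rw [h, zero_re] at hs; linarith
  have hs1 : s ≠ 1 := fun h ↦ by rw [h, one_re] at hs; exact lt_irrefl _ hs
  have hU : ∀ᶠ z : ℂ in 𝓝 s, 1 < z.re := (isOpen_lt continuous_const continuous_re).mem_nhds hs
  set Λ₁ := twistVonMangoldt K (classGroupCharIdealHom χ) with hΛ₁
  set Λ₂ := twistVonMangoldt K (classGroupCharIdealHom χ⁻¹) with hΛ₂
  -- the identity of functions near `s`
  have hev : (fun z ↦ LSeries Λ₁ z + LSeries Λ₂ z) =ᶠ[𝓝 s] fun z ↦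
      (2 / z + 2 / (z - 1)) + (2 * logDeriv (dedekindGammaFactor K) z - logDeriv (classXiPair K χ) z) := by
    filter_upwards [hU] with z hz
    have h := logDeriv_classXiPair χ hz
    rw [logDeriv_classGroupLFunction_eq_neg_LSeries χ hz,
      logDeriv_classGroupLFunction_eq_neg_LSeries χ⁻¹ hz] at h
    rw [hΛ₁, hΛ₂]
    linear_combination h
  -- smoothness of the pieces at `s`
  have hL₁ : ContDiffAt ℂ k (LSeries Λ₁) s := contDiffAt_LSeries_twistVonMangoldt χ hs k
  have hL₂ : ContDiffAt ℂ k (LSeries Λ₂) s := contDiffAt_LSeries_twistVonMangoldt χ⁻¹ hs k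
  have hP : ContDiffAt ℂ k (fun z : ℂ ↦ 2 / z + 2 / (z - 1)) s := by
    have h0 : ContDiffAt ℂ k (fun z : ℂ ↦ 2 / z) s := contDiffAt_const.div contDiffAt_id hs0
    have h1 : ContDiffAt ℂ k (fun z : ℂ ↦ 2 / (z - 1)) s :=
      contDiffAt_const.div (contDiffAt_id.sub contDiffAt_const) (sub_ne_zero.mpr hs1)
    exact h0.add h1
  have hO : IsOpen {z : ℂ | 0 < z.re} := isOpen_lt continuous_const continuous_re
  have hγ : ContDiffAt ℂ k (logDeriv (dedekindGammaFactor K)) s := by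
    have hd : DifferentiableOn ℂ (logDeriv (dedekindGammaFactor K)) {z : ℂ | 0 < z.re} := by
      intro z hz
      have hz' : ∀ m : ℕ, z ≠ -m := ne_neg_nat_of_re_pos hz
      have hγ0 : dedekindGammaFactor K z ≠ 0 := dedekindGammaFactor_ne_zero_of_re_pos hz
      have hγa : AnalyticAt ℂ (dedekindGammaFactor K) z :=
        DifferentiableOn.analyticAt (s := {z : ℂ | 0 < z.re})
          (fun w hw ↦ (differentiableAt_dedekindGammaFactor (ne_neg_nat_of_re_pos hw)).differentiableWithinAt)
          (hO.mem_nhds hz)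
      have : logDeriv (dedekindGammaFactor K) = fun w ↦ deriv (dedekindGammaFactor K) w / dedekindGammaFactor K w := by
        funext w; rw [logDeriv_apply]
      rw [this]
      exact (hγa.deriv.differentiableAt.div hγa.differentiableAt hγ0).differentiableWithinAt
    exact (hd.analyticAt (hO.mem_nhds hs0')).contDiffAt
  have hΞne : classXiPair K χ s ≠ 0 := classXiPair_ne_zero_of_one_lt_re χ hs
  have hΞ : ContDiffAt ℂ k (logDeriv (classXiPair K χ)) s := by
    have hV : IsOpen {z : ℂ | classXiPair K χ z ≠ 0} :=
      isOpen_ne_fun (differentiable_classXiPair χ).continuous continuous_const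
    have hd : DifferentiableOn ℂ (logDeriv (classXiPair K χ)) {z : ℂ | classXiPair K χ z ≠ 0} :=
      fun z hz ↦ (SymmHadamardData.differentiableAt_logDeriv (differentiable_classXiPair χ) hz).differentiableWithinAt
    exact (hd.analyticAt (hV.mem_nhds hΞne)).contDiffAt
  -- differentiate `k` times
  have hk0 : 0 < k := hk
  have hlhs : iteratedDeriv k (fun z ↦ LSeries Λ₁ z + LSeries Λ₂ z) s =
      iteratedDeriv k (LSeries Λ₁) s + iteratedDeriv k (LSeries Λ₂) s := iteratedDeriv_fun_add hL₁ hL₂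
  have hrhs : iteratedDeriv k (fun z ↦ (2 / z + 2 / (z - 1)) +
      (2 * logDeriv (dedekindGammaFactor K) z - logDeriv (classXiPair K χ) z)) s =
      iteratedDeriv k (fun z : ℂ ↦ 2 / z + 2 / (z - 1)) s +
        (2 * iteratedDeriv k (logDeriv (dedekindGammaFactor K)) s -
          iteratedDeriv k (logDeriv (classXiPair K χ)) s) := by
    rw [iteratedDeriv_fun_add hP ((contDiffAt_const.mul hγ).sub hΞ),
      iteratedDeriv_fun_sub (contDiffAt_const.mul hγ) hΞ, iteratedDeriv_const_mul _ hγ]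
  have hmain := hev.iteratedDeriv_eq (n := k)
  rw [hlhs, hrhs, iteratedDeriv_poleTerms hs0 hs1,
    D.iteratedDeriv_logDeriv_eq (differentiable_classXiPair χ) hΞne k] at hmain
  rw [hmain, (hasSum_iteratedDeriv_logDeriv_dedekindGammaFactor K hs0' hk).tsum_eq.symm, tsum_mul_left]
  set G : ℂ := ∑' j : ℕ, ((nrRealPlaces K : ℂ) * ((s + 2 * j) ^ (k + 1))⁻¹ +
    (nrComplexPlaces K : ℂ) * ((s + j) ^ (k + 1))⁻¹) with hG
  set Z : ℂ := 2 * D.m * ((s - 1 / 2) ^ (k + 1))⁻¹ + ∑' n, D.zeroTerm k s n with hZ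
  set A : ℂ := (s ^ (k + 1))⁻¹ with hA
  set B : ℂ := ((s - 1) ^ (k + 1))⁻¹ with hB
  have hfac : (k.factorial : ℂ) ≠ 0 := by exact_mod_cast k.factorial_ne_zero
  have hinv : (k.factorial : ℂ) * (k.factorial : ℂ)⁻¹ = 1 := mul_inv_cancel₀ hfac
  have hε : ((-1 : ℂ) ^ k) * (-1) ^ k = 1 := by rw [← mul_pow]; simp
  have e1 : ((-1 : ℂ) ^ (k + 1)) = -(-1) ^ k := by rw [pow_succ, mul_neg_one]
  rw [e1, div_eq_mul_inv]
  linear_combination ((k.factorial : ℂ) * (k.factorial : ℂ)⁻¹ * (2 * A + 2 * B - 2 * G - Z)) * hε +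
    (2 * A + 2 * B - 2 * G - Z) * hinv

/-- **The explicit formula for the pair sum `P_k(χ, s)`** (`pairLSeries`), `Re s > 1`, `k ≥ 1`:
`P_k(χ,s) = 2(s−1)^{−k−1} + 2s^{−k−1} − 2Σ_j(r₁(s+2j)^{−k−1} + r₂(s+j)^{−k−1}) − 2m(s−½)^{−k−1} − Σₙ Zₙ(k,s)`.
[cite: ThornerZaman2017, §7 (7.3)] -/
theorem pairLSeries_explicit (χ : ClassGroup (𝓞 K) →* ℂˣ) (D : SymmHadamardData (classXiPair K χ))
    {s : ℂ} (hs : 1 < s.re) {k : ℕ} (hk : 1 ≤ k) :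
    pairLSeries K χ k s =
      2 * ((s - 1) ^ (k + 1))⁻¹ + 2 * (s ^ (k + 1))⁻¹ -
        2 * ∑' j : ℕ, ((nrRealPlaces K : ℂ) * ((s + 2 * j) ^ (k + 1))⁻¹ +
          (nrComplexPlaces K : ℂ) * ((s + j) ^ (k + 1))⁻¹) -
        (2 * D.m * ((s - 1 / 2) ^ (k + 1))⁻¹ + ∑' n, D.zeroTerm k s n) := by
  rw [pairLSeries_eq_iteratedDeriv χ k hs]
  exact pairExplicitFormula χ D hs hk

end Literature.NumberTheory.LFunctions.NumberField

end
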